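import Literature.AlgebraicGeometry.HodgeTheory.AlgebraicityLocus
import Literature.AlgebraicGeometry.Motives.ComplexPointsEhresmann
import Literature.AlgebraicTopology.SingularHomology.UniversalCoefficientsField
import Literature.AlgebraicTopology.SingularHomology.CompactSupports
import Literature.NumberTheory.Transcendental.AnalytificationClosure
import HarnessLib

/-!
# Upper semicontinuity of supports in families: the locus where a global class dies off a closed family of subsets of the fibres is closed

Family `hodge`, layer `Literature/AlgebraicGeometry/HodgeTheory`; companion of
`AlgebraicityLocus.lean` (the structure theorem `charlesSchnell_algebraicityLocus_iUnion_closed` on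
algebraicity loci, Charles–Schnell 2014, proof of Prop. 11.3.11; Voisin, *Hodge Theory II*, §3.3.1,
§7.3.2) and of `AlgebraicityLocusParametrised.lean` (its reduction to countably many PROPER
parameter schemes `h_i : H_i ⟶ S` with good sets `good_i ⊆ H_i(ℂ)`).

On the tree's carriers the algebraic classes of a fibre are SUPPORT-defined
(`algebraicClasses (𝒳_t) p = Nᵖ H²ᵖ(𝒳_t(ℂ); ℂ)`, the sum of the kernels
`ker (H²ᵖ(𝒳_t(ℂ)) → H²ᵖ((𝒳_t ∖ Z)(ℂ)))` over Zariski-closed `Z` of codimension `≥ p`), so the good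
sets of the printed proof ("`A|_{𝒳_t}` is supported on the member `Z_y` of the family parametrised
by `y ∈ H_i(ℂ)`") are sets of the shape

  `G = {y | A|_{𝒳_{h(y)}} ∈ ker (H^k(𝒳_{h(y)}(ℂ)) → H^k((𝒳_{h(y)} ∖ Z_y)(ℂ)))}`

for a family of subsets `Z_y ⊆ 𝒳_{h(y)}` cut out of the fibres by ONE closed subset
`C ⊆ Y × 𝒳(ℂ)` of the total space of parameters and points. This file PROVES (sorry-free; theorems
only, no named fact, no definition) that such a `G` is CLOSED in the parameter space `Y` (strong
topology) as soon as `f(ℂ) : 𝒳(ℂ) → S(ℂ)` is a locally trivial fibration over a locally path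
connected base — in
particular for a smooth projective family over a smooth base (Ehresmann, Voisin I Thm. 9.3, the
tree's `Motives.ComplexPoints.isLocallyTrivialFibration_map_of_smoothOfRelativeDimension`). This is
the UPPER SEMICONTINUITY OF SUPPORTS: supports of the members of a closed family can only grow in
the limit, and a class dying off `Z_{y_n}` for `y_n → y₀` dies off `Z_{y₀}`. It is the
analytic-topology half of the closedness of the good sets (the other half of the printed argument,
local constancy along flat families, transports cycle classes; here no cycle class is needed), and
the input of the closure step "if `A|_{𝒳_t}` is supported on `Z_u` for `u` in a dense set of
parameters then it is supported on the limit member" of the structure theorem.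

* `singularCohomology_map_eq_zero_of_compact_homotopy` — **vanishing is detected on compacta, up to
  homotopy**: for `ι : U₀ → E` and `A ∈ Hᵏ(E; F)` (`F` a field), if every compact `K ⊆ U₀` maps,
  up to a homotopy of `ι|_K` in `E`, into some `i' : U' → E` with `i'^* A = 0`, then `ι^* A = 0`
  (universal coefficients over a field: the Kronecker map `Hᵏ → Hom(Hₖ, F)` is one-to-one,
  Hatcher Thm. 3.2; compact supports of homology classes, Hatcher §3.3 p. 244; homotopy
  invariance, Hatcher Thm. 2.10).
* `isClosed_setOf_map_subtypeVal_eq_zero` (`…_of_isLocallyTrivialFibration`) — **the pure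
  topological theorem**: `p : E → B` a locally trivial fibration, `B` locally path connected,
  `h : Y → B` continuous, `C ⊆ Y × E` closed, `A ∈ Hᵏ(E; F)`; then `{y | A|_{p⁻¹(h y) ∖ C_y} = 0}`
  is closed in `Y`. Proof: for `y₀` in its closure and a compact `K ⊆ p⁻¹(h y₀) ∖ C_{y₀}`, a local
  trivialisation `V × F₀ ≃ p⁻¹V` near `h y₀` moves `K` into the nearby fibres, `p⁻¹(h y) ∖ C_y`
  receives the moved `K` for `y` near `y₀` (tube lemma, `C` closed), some such `y` lies in the
  set, and the motion along a path from `h y₀` to `h y` in `V` is a homotopy in `E`.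
* `isClosed_setOf_map_fiberι_mem_ker_restrictCompl` — **the theorem on the real carriers**: for
  `f : 𝒳 ⟶ S` proper with `𝒳` separated over `ℂ`, `f(ℂ)` a locally trivial fibration and `S(ℂ)`
  locally path connected, a continuous `h : Y → S(ℂ)`, a closed `C ⊆ Y × 𝒳(ℂ)` and subsets
  `Z y ⊆ 𝒳_{h y}` of the scheme-theoretic fibres (`Motives.fiberOver`) whose complex points are cut
  out by `C`, the set `{y | A|_{𝒳_{h y}} ∈ ker (complexBetti.restrictCompl (𝒳_{h y}) (Z y) k)}` is
  closed (`𝒳_{h y}(ℂ) → f(ℂ)⁻¹(h y)` is a homeomorphism, `exists_homeomorph_fiberOver_preimage`: a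
  continuous bijection from a compact space to a Hausdorff one, Mumford I.10).
* `isClosed_setOf_map_fiberι_mem_ker_restrictCompl_of_isSmoothProjectiveFamily` — the same for a
  smooth projective family `f` (`Motives.IsSmoothProjectiveFamily f n`) over a quasi-projective base
  smooth over `ℂ` (Ehresmann on complex points over the pieces of constant dimension,
  `exists_trivialisation_map_of_smooth`; `S(ℂ)` is locally a real manifold, hence locally path
  connected, `locallyPathConnectedSpace_complexPoints_of_smooth`).
* `isClosed_setOf_map_fiberι_mem_ker_restrictCompl_preimage` — the form with scheme data: a
  parameter scheme `g : H ⟶ S`, a Zariski-closed `𝒵 ⊆ 𝒳 × H`, and `Z y ⊆ 𝒳_{g(y)}` the slice of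
  `𝒵` over `y ∈ H(ℂ)` (preimage under `(ι_{g(y)}, y) : 𝒳_{g(y)} → 𝒳 × H`); the good set is closed
  in `H(ℂ)` (`(𝒳 × H)(ℂ) = 𝒳(ℂ) × H(ℂ)` topologically, `AlgPoints.continuous_prodEquiv_symm`).
* `setOf_pt_mem_closure_subset_of_isClosed`, `eq_iUnion_setOf_pt_mem_closure_of_isClosed`,
  `map_fiberι_mem_ker_restrictCompl_of_pt_mem_closure` — **consequences via SGA1 XII Prop. 2.2**
  (the tree's proved `Motives.ComplexPoints.closure_setOf_pt_mem_holds`: the complex points over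
  the Zariski closure of a locally constructible `T ⊆ H` form the strong closure of those over
  `T`): a strongly closed set of complex points containing `T(ℂ)` contains `T̄(ℂ)`; a strongly
  closed countable union of locally constructible pieces `T_i(ℂ)` is the countable union of the
  Zariski-CLOSED `T̄_i(ℂ)`; and supportedness of `A|_{𝒳_{g(y)}}` on the slices `Z y` at the complex
  points over `T` passes to all complex points over `T̄` — the device by which the structure theorem
  turns good constructible pieces of the parameter schemes into closed subvarieties.

## References

* [CharlesSchnell2014Notes] F. Charles, C. Schnell, Notes on absolute Hodge classes, in Hodge Theory
  (Princeton Math. Notes 49, 2014), Prop. 11.3.11 (proof).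
* [VoisinHodgeII2003] C. Voisin, Hodge Theory and Complex Algebraic Geometry II (2003), §3.3.1,
  §7.3.2 (proof of Thm. 7.19).
* [VoisinHodgeI2002] C. Voisin, Hodge Theory and Complex Algebraic Geometry I (2002), Thm. 9.3,
  §9.2.1.
* [HatcherAT2002] A. Hatcher, Algebraic Topology (2002), Thm. 2.10, §3.1 Thm. 3.2, §3.3 p. 244.
* [MumfordRedBook1999] D. Mumford, The Red Book of Varieties and Schemes, I.10 Thm. 1–2.
* [SGA1] A. Grothendieck, M. Raynaud, SGA 1, Exp. XII, Prop. 2.2, Prop. 3.1, Prop. 3.2.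
-/

noncomputable section

open CategoryTheory AlgebraicGeometry Set Filter _root_.Topology
open Literature.AlgebraicTopology.SingularHomology Literature.AlgebraicTopology.Homotopy

universe u v

namespace Literature.AlgebraicGeometry.HodgeTheory

section HodgeTheory

/-! ### Vanishing of a class is detected on compacta, up to homotopy -/

section Topology

variable (F : Type v) [Field F]

/-- **Vanishing of a restricted class is detected on compacta, up to homotopy.** Let `ι : U₀ → E`,
`A ∈ Hᵏ(E; F)` over a field `F`, and suppose that for every compact `K ⊆ U₀` there are a space `U'`,
a map `i' : U' → E` killing `A` and a map `ψ : K → U'` with `i' ∘ ψ` homotopic to `ι|_K` in `E`.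
Then `ι^* A = 0`: by universal coefficients over a field it suffices to pair `ι^* A` with the
classes of `Hₖ(U₀; F)`, each of which is carried by a compact `K` (compact supports), and
`⟨ι^* A, (K ↪ U₀)_* γ⟩ = ⟨A, (ι|_K)_* γ⟩ = ⟨A, (i' ∘ ψ)_* γ⟩ = ⟨i'^* A, ψ_* γ⟩ = 0` (naturality of
the Kronecker pairing and homotopy invariance).
[cite: HatcherAT2002, §3.1 Thm. 3.2, §3.3 p. 244, Thm. 2.10] -/
theorem singularCohomology_map_eq_zero_of_compact_homotopy {E U₀ : Type u} [TopologicalSpace E]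
    [TopologicalSpace U₀] (ι : C(U₀, E)) {k : ℕ} (A : singularCohomology F F E k)
    (h : ∀ K : Set U₀, IsCompact K →
      ∃ (U' : Type u) (_ : TopologicalSpace U') (i' : C(U', E)) (ψ : C(K, U')),
        singularCohomology.map F F i' k A = 0 ∧
          (i'.comp ψ).Homotopic (ι.comp ⟨Subtype.val, continuous_subtype_val⟩)) :
    singularCohomology.map F F ι k A = 0 := by
  apply kroneckerPairing_injective_of_field F U₀ k
  rw [map_zero]
  refine LinearMap.ext fun γ => ?_
  obtain ⟨K, hK, γ', rfl⟩ := singularHomology.exists_isCompact_mem_range_map F F γ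
  obtain ⟨U', _, i', ψ, hA, hhom⟩ := h K hK
  rw [LinearMap.zero_apply, ← kroneckerPairing_map, ← ModuleCat.comp_apply,
    ← singularCohomology.map_comp, ← singularCohomology.map_eq_of_homotopic' F F hhom,
    singularCohomology.map_comp, ModuleCat.comp_apply, hA, map_zero, map_zero, LinearMap.zero_apply]

/-! ### The pure topological theorem: supports in a closed family are upper semicontinuous -/

variable {E B Y : Type u} [TopologicalSpace E] [TopologicalSpace B] [TopologicalSpace Y]

/-! In what follows, for `p : E → B`, `C ⊆ Y × E`, `y ∈ Y` and `b ∈ B`, the subspace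
`{e' : E // p e' = b ∧ (y, e') ∉ C}` of `E` is the part of the fibre `p⁻¹(b)` off the slice
`C_y = {e | (y, e) ∈ C}`, and `⟨Subtype.val, _⟩` its inclusion in `E`. -/

/-- **Upper semicontinuity of supports (topological form).** Let `p : E → B` be topologically
locally trivial (near every point of `B` a trivialisation `V × F₀ ≃ p⁻¹V` over `V` with SOME fibre
`F₀`; e.g. a locally trivial fibration,
`isClosed_setOf_map_subtypeVal_eq_zero_of_isLocallyTrivialFibration`) over a locally path
connected space `B`, `h : Y → B` continuous, `C ⊆ Y × E` closed and
`A ∈ Hᵏ(E; F)` (`F` a field). Then the set of parameters `y` at which `A` dies on the fibre off the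
slice, `A|_{p⁻¹(h y) ∖ C_y} = 0`, is CLOSED in `Y`. For `y₀` in the closure and a compact
`K ⊆ p⁻¹(h y₀) ∖ C_{y₀}`: a trivialisation `φ : V × p⁻¹(h y₀) ≃ p⁻¹V` near `h y₀`, normalised by
`φ⁻¹`, moves `K` continuously into the fibres `p⁻¹(b)`, `b ∈ V`; since `C` is closed and `K`
compact, the moved `K` misses `C_y` for all `y` near `y₀` (tube lemma); choosing such a `y` in the
set with `h y` in a path connected neighbourhood inside `V`, the motion of `K` along a path from
`h y₀` to `h y` is a homotopy in `E` from `K ↪ E` to a map into `p⁻¹(h y) ∖ C_y`, on which `A`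
dies; so `A|_{p⁻¹(h y₀) ∖ C_{y₀}}` pairs to zero with every homology class
(`singularCohomology_map_eq_zero_of_compact_homotopy`). [folklore] -/
theorem isClosed_setOf_map_subtypeVal_eq_zero {p : E → B}
    (hp : ∀ b : B, ∃ V : Set B, IsOpen V ∧ b ∈ V ∧
      ∃ (F₀ : Type u) (_ : TopologicalSpace F₀) (φ : V × F₀ ≃ₜ p ⁻¹' V), ∀ x, p (φ x) = x.1)
    [LocallyPathConnectedSpace B] (h : C(Y, B)) {C : Set (Y × E)} (hC : IsClosed C) {k : ℕ}
    (A : singularCohomology F F E k) :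
    IsClosed {y : Y | singularCohomology.map F F
      (⟨Subtype.val, continuous_subtype_val⟩ : C({e : E // p e = h y ∧ (y, e) ∉ C}, E)) k A =
        0} := by
  refine isClosed_iff_clusterPt.2 fun y₀ hy₀ => ?_
  replace hy₀ : y₀ ∈ closure {y : Y | singularCohomology.map F F
      (⟨Subtype.val, continuous_subtype_val⟩ : C({e : E // p e = h y ∧ (y, e) ∉ C}, E)) k A = 0} :=
    mem_closure_iff_clusterPt.2 hy₀
  -- a local trivialisation near `h y₀` and a path connected neighbourhood inside it
  obtain ⟨V, hVo, hV₀, F₀, _, φ, hφ⟩ := hp (h y₀)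
  obtain ⟨W, ⟨hWn, hWpc, hWV⟩, -⟩ :=
    (pathConnected_subset_basis hVo hV₀).mem_iff.1 (hVo.mem_nhds hV₀)
  apply singularCohomology_map_eq_zero_of_compact_homotopy
  intro K hK
  haveI : CompactSpace K := isCompact_iff_compactSpace.1 hK
  -- points of `K` as points of `p⁻¹ V` and their fibre coordinates
  have hKV : ∀ κ : K, (κ : {e : E // p e = h y₀ ∧ (y₀, e) ∉ C}).1 ∈ p ⁻¹' V := fun κ => by
    rw [mem_preimage, κ.1.2.1]; exact hV₀
  let ξ : K → F₀ := fun κ => (φ.symm ⟨_, hKV κ⟩).2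
  have hξ : Continuous ξ :=
    continuous_snd.comp (φ.symm.continuous.comp ((continuous_subtype_val.comp
      continuous_subtype_val).subtype_mk _))
  have hφξ : ∀ κ : K, (φ (⟨h y₀, hV₀⟩, ξ κ) : E) = (κ : {e : E // p e = h y₀ ∧ (y₀, e) ∉ C}).1 :=
      fun κ => by
    have h1 : (φ.symm ⟨_, hKV κ⟩).1 = ⟨h y₀, hV₀⟩ := by
      apply Subtype.ext
      have := hφ (φ.symm ⟨_, hKV κ⟩)
      rw [φ.apply_symm_apply] at this
      rw [← this]
      exact κ.1.2.1
    change (φ (⟨h y₀, hV₀⟩, (φ.symm ⟨_, hKV κ⟩).2) : E) = _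
    rw [← h1, Prod.mk.eta, φ.apply_symm_apply]
  -- the motion of `K` into the fibre over `b ∈ V`
  let Θ : V × K → E := fun x => φ (x.1, ξ x.2)
  have hΘ : Continuous Θ :=
    continuous_subtype_val.comp (φ.continuous.comp (continuous_fst.prodMk (hξ.comp continuous_snd)))
  have hpΘ : ∀ x : V × K, p (Θ x) = x.1 := fun x => hφ _
  -- for `y` near `y₀` the moved `K` misses `C_y` (tube lemma)
  let O : Set (h ⁻¹' V × K) := {x | (x.1.1, Θ (⟨h x.1.1, x.1.2⟩, x.2)) ∉ C}
  have hO : IsOpen O := by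
    have hc : Continuous fun x : h ⁻¹' V × K => (x.1.1, Θ (⟨h x.1.1, x.1.2⟩, x.2)) :=
      (continuous_subtype_val.comp continuous_fst).prodMk
        (hΘ.comp (((h.continuous.comp (continuous_subtype_val.comp continuous_fst)).subtype_mk
          _).prodMk continuous_snd))
    exact hC.isOpen_compl.preimage hc
  have hy₀V : y₀ ∈ h ⁻¹' V := hV₀
  have hO₀ : ({(⟨y₀, hy₀V⟩ : h ⁻¹' V)} : Set (h ⁻¹' V)) ×ˢ (univ : Set K) ⊆ O := by
    rintro ⟨y, κ⟩ ⟨hy, -⟩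
    rw [mem_singleton_iff] at hy
    subst hy
    change (y₀, Θ (⟨h y₀, hV₀⟩, κ)) ∉ C
    change (y₀, (φ (⟨h y₀, hV₀⟩, ξ κ) : E)) ∉ C
    rw [hφξ]
    exact κ.1.2.2
  obtain ⟨N, M, hNo, -, hN₀, hM, hN⟩ :=
    generalized_tube_lemma isCompact_singleton isCompact_univ hO hO₀
  have hN₀' : (⟨y₀, hy₀V⟩ : h ⁻¹' V) ∈ N := hN₀ (mem_singleton _)
  -- a parameter `y` in the set, near `y₀`, with `h y ∈ W`
  have hnhds : (Subtype.val '' N) ∩ h ⁻¹' W ∈ 𝓝 y₀ := by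
    refine inter_mem ?_ (h.continuous.continuousAt.preimage_mem_nhds hWn)
    have hNo' : IsOpen (Subtype.val '' N : Set Y) :=
      (hVo.preimage h.continuous).isOpenMap_subtype_val _ hNo
    exact hNo'.mem_nhds ⟨_, hN₀', rfl⟩
  obtain ⟨y, ⟨⟨y', hy'N, rfl⟩, hyW⟩, hyG⟩ := mem_closure_iff_nhds.1 hy₀ _ hnhds
  have hyV : h y' ∈ V := hWV hyW
  -- the fibre over `h y` off `C_y` receives the moved `K`
  have hmiss : ∀ κ : K, (y'.1, Θ (⟨h y', hyV⟩, κ)) ∉ C := fun κ => by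
    have : (y', κ) ∈ O := hN (mk_mem_prod hy'N (hM (mem_univ κ)))
    exact this
  let ψ : C(K, {e : E // p e = h y' ∧ (y'.1, e) ∉ C}) :=
    ⟨fun κ => ⟨Θ (⟨h y', hyV⟩, κ), hpΘ _, hmiss κ⟩,
      (hΘ.comp (continuous_const.prodMk continuous_id)).subtype_mk _⟩
  refine ⟨{e : E // p e = h y' ∧ (y'.1, e) ∉ C}, inferInstance,
    ⟨Subtype.val, continuous_subtype_val⟩, ψ, hyG, ?_⟩
  -- the motion along a path from `h y₀` to `h y` in `W ⊆ V` is the homotopy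
  have hJ : JoinedIn W (h y₀) (h y') := hWpc.joinedIn _ (mem_of_mem_nhds hWn) _ hyW
  let γ : Path (h y₀) (h y') := hJ.somePath
  have hγ : ∀ s, γ s ∈ V := fun s => hWV (hJ.somePath_mem s)
  refine ⟨ContinuousMap.Homotopy.symm ⟨⟨fun x => Θ (⟨γ x.1, hγ x.1⟩, x.2), ?_⟩, ?_, ?_⟩⟩
  · exact hΘ.comp (((γ.continuous.comp continuous_fst).subtype_mk _).prodMk continuous_snd)
  · intro κ
    change Θ (⟨γ 0, hγ 0⟩, κ) = (κ : {e : E // p e = h y₀ ∧ (y₀, e) ∉ C}).1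
    have h0 : (⟨γ 0, hγ 0⟩ : V) = ⟨h y₀, hV₀⟩ := Subtype.ext γ.source
    rw [h0]
    exact hφξ κ
  · intro κ
    change Θ (⟨γ 1, hγ 1⟩, κ) = Θ (⟨h y', hyV⟩, κ)
    have h1 : (⟨γ 1, hγ 1⟩ : V) = ⟨h y', hyV⟩ := Subtype.ext γ.target
    rw [h1]

/-- `isClosed_setOf_map_subtypeVal_eq_zero` for a locally trivial fibration `p`
(`IsLocallyTrivialFibration`: trivialisations `V × p⁻¹(b) ≃ p⁻¹V`). [folklore] -/
theorem isClosed_setOf_map_subtypeVal_eq_zero_of_isLocallyTrivialFibration {p : E → B}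
    (hp : IsLocallyTrivialFibration p) [LocallyPathConnectedSpace B] (h : C(Y, B))
    {C : Set (Y × E)} (hC : IsClosed C) {k : ℕ} (A : singularCohomology F F E k) :
    IsClosed {y : Y | singularCohomology.map F F
      (⟨Subtype.val, continuous_subtype_val⟩ : C({e : E // p e = h y ∧ (y, e) ∉ C}, E)) k A = 0} :=
  isClosed_setOf_map_subtypeVal_eq_zero F
    (fun b => by
      obtain ⟨V, hVo, hbV, φ, hφ⟩ := hp b
      exact ⟨V, hVo, hbV, _, inferInstance, φ, hφ⟩)
    h hC A

end Topology

/-! ### The theorem on the real carriers: fibres of a proper family, `complexBetti.restrictCompl` -/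

section Schemes

variable {𝒳 S : Motives.SchemeOver ℂ} (f : 𝒳 ⟶ S)

/-- **The complex points of the scheme-theoretic fibre are the topological fibre**: for `f : 𝒳 ⟶ S`
proper with `𝒳` separated over `ℂ` and `t ∈ S(ℂ)`, the map `𝒳_t(ℂ) → 𝒳(ℂ)` induced by
`Motives.fiberι f t` underlies a homeomorphism onto `f(ℂ)⁻¹(t)` — a continuous bijection
(`Motives.AlgPoints.map_fiberι_injective`, `Motives.AlgPoints.range_map_fiberι`) from a compact
space (`𝒳_t` is proper over `ℂ`, Mumford I.10 Thm. 2 = the tree's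
`Motives.compactSpace_algPoints_of_isProper_holds`) to a Hausdorff one.
[cite: MumfordRedBook1999, I.10 Thm. 1–2] -/
theorem exists_homeomorph_fiberOver_preimage [IsProper f.left] [IsSeparated 𝒳.hom]
    (t : Motives.ComplexPoints S) :
    ∃ e : Motives.ComplexPoints (Motives.fiberOver f t) ≃ₜ
        (Motives.AlgPoints.map f ⁻¹' ({t} : Set (Motives.ComplexPoints S))),
      ∀ P, (e P : Motives.ComplexPoints 𝒳) = Motives.AlgPoints.map (Motives.fiberι f t) P := by
  haveI : IsProper (Motives.fiberOver f t).hom := isProper_fiberOver_hom f t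
  haveI : CompactSpace (Motives.ComplexPoints (Motives.fiberOver f t)) :=
    Motives.compactSpace_algPoints_of_isProper_holds _ ℂ
  haveI : T2Space (Motives.ComplexPoints 𝒳) := Motives.ComplexPoints.t2Space_of_isSeparated 𝒳
  have hmem : ∀ P : Motives.ComplexPoints (Motives.fiberOver f t),
      Motives.AlgPoints.map (Motives.fiberι f t) P ∈
        Motives.AlgPoints.map f ⁻¹' ({t} : Set (Motives.ComplexPoints S)) := fun P =>
    Motives.AlgPoints.map_map_fiberι f t P
  have hbij : Function.Bijective fun P : Motives.ComplexPoints (Motives.fiberOver f t) =>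
      (⟨Motives.AlgPoints.map (Motives.fiberι f t) P, hmem P⟩ :
        (Motives.AlgPoints.map f ⁻¹' ({t} : Set (Motives.ComplexPoints S)))) := by
    refine ⟨fun P Q h => Motives.AlgPoints.map_fiberι_injective f t (congrArg Subtype.val h),
      fun P => ?_⟩
    obtain ⟨Q, hQ⟩ : P.1 ∈ Set.range (Motives.AlgPoints.map (Motives.fiberι f t)) := by
      rw [Motives.AlgPoints.range_map_fiberι]; exact P.2
    exact ⟨Q, Subtype.ext hQ⟩
  exact ⟨Continuous.homeoOfEquivCompactToT2 (f := Equiv.ofBijective _ hbij)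
    ((Motives.AlgPoints.continuous_map _).subtype_mk _), fun P => rfl⟩

variable {Y : Type} [TopologicalSpace Y]

omit [TopologicalSpace Y] in
/-- **The fibre off `Z y` versus the topological fibre off the slice `C_y`.** In the situation of
`isClosed_setOf_map_fiberι_mem_ker_restrictCompl` (subsets `Z y ⊆ 𝒳_{h y}` whose complex points are
cut out by the closed `C ⊆ Y × 𝒳(ℂ)`), `A|_{𝒳_{h y}}` dies off `Z y` iff `A` dies on the
topological fibre `f(ℂ)⁻¹(h y)` off `C_y`: the two spaces are homeomorphic over `𝒳(ℂ)`
(`exists_homeomorph_fiberOver_preimage`). [folklore] -/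
theorem map_fiberι_mem_ker_restrictCompl_iff [IsProper f.left] [IsSeparated 𝒳.hom]
    (h : Y → Motives.ComplexPoints S) (C : Set (Y × Motives.ComplexPoints 𝒳))
    (Z : ∀ y : Y, Set (Motives.fiberOver f (h y)).left)
    (hZ : ∀ (y : Y) (P : Motives.ComplexPoints (Motives.fiberOver f (h y))),
      P.pt ∈ Z y ↔ (y, Motives.AlgPoints.map (Motives.fiberι f (h y)) P) ∈ C)
    (k : ℕ) (A : complexBetti 𝒳 k) (y : Y) :
    complexBetti.map (Motives.fiberι f (h y)) k A ∈
        LinearMap.ker (complexBetti.restrictCompl (Motives.fiberOver f (h y)) (Z y) k).hom ↔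
      singularCohomology.map ℂ ℂ (⟨Subtype.val, continuous_subtype_val⟩ :
        C({e : Motives.ComplexPoints 𝒳 // Motives.AlgPoints.map f e = h y ∧ (y, e) ∉ C},
          Motives.ComplexPoints 𝒳)) k A = 0 := by
  obtain ⟨e, he⟩ := exists_homeomorph_fiberOver_preimage f (h y)
  -- the homeomorphism `(𝒳_{h y} ∖ Z y)(ℂ) ≃ f(ℂ)⁻¹(h y) ∖ C_y` over `𝒳(ℂ)`
  have h1 : ∀ P : Motives.complexPointsCompl (Motives.fiberOver f (h y)) (Z y),
      Motives.AlgPoints.map f (e P.1 : Motives.ComplexPoints 𝒳) = h y ∧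
        (y, (e P.1 : Motives.ComplexPoints 𝒳)) ∉ C := fun P =>
    ⟨(e P.1).2, fun hP => P.2 ((hZ y P.1).2 (by rwa [he] at hP))⟩
  have h2 : ∀ w : {e : Motives.ComplexPoints 𝒳 // Motives.AlgPoints.map f e = h y ∧ (y, e) ∉ C},
      (e.symm ⟨w.1, w.2.1⟩).pt ∉ Z y := fun w hw => by
    have hw' := (hZ y _).1 hw
    rw [← he, e.apply_symm_apply] at hw'
    exact w.2.2 hw'
  let β : Motives.complexPointsCompl (Motives.fiberOver f (h y)) (Z y) ≃ₜ
      {e : Motives.ComplexPoints 𝒳 // Motives.AlgPoints.map f e = h y ∧ (y, e) ∉ C} :=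
    { toFun := fun P => ⟨e P.1, h1 P⟩
      invFun := fun w => ⟨e.symm ⟨w.1, w.2.1⟩, h2 w⟩
      left_inv := fun P => by
        apply Subtype.ext
        change e.symm ⟨(e P.1 : Motives.ComplexPoints 𝒳), _⟩ = P.1
        rw [Subtype.coe_eta, e.symm_apply_apply]
      right_inv := fun w => by
        apply Subtype.ext
        change ((e (e.symm ⟨w.1, w.2.1⟩)) : Motives.ComplexPoints 𝒳) = w.1
        rw [e.apply_symm_apply]
      continuous_toFun := (continuous_subtype_val.comp (e.continuous.comp
        continuous_subtype_val)).subtype_mk _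
      continuous_invFun :=
        (e.symm.continuous.comp (continuous_subtype_val.subtype_mk _)).subtype_mk _ }
  -- the restriction of `A|_{𝒳_{h y}}` off `Z y` is the pull-back along `ι_{h y} ∘ val = incl ∘ β`
  have hfac : (Motives.AlgPoints.mapContinuous (L := ℂ) (Motives.fiberι f (h y))).comp
      (⟨Subtype.val, continuous_subtype_val⟩ :
        C(Motives.complexPointsCompl (Motives.fiberOver f (h y)) (Z y),
          Motives.ComplexPoints (Motives.fiberOver f (h y)))) =
      (⟨Subtype.val, continuous_subtype_val⟩ :
        C({e : Motives.ComplexPoints 𝒳 // Motives.AlgPoints.map f e = h y ∧ (y, e) ∉ C},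
          Motives.ComplexPoints 𝒳)).comp (β : C(_, _)) := by
    ext P : 1
    exact (he P.1).symm
  have hcomp : complexBetti.restrictCompl (Motives.fiberOver f (h y)) (Z y) k
      (complexBetti.map (Motives.fiberι f (h y)) k A) =
        singularCohomology.map ℂ ℂ (β : C(_, _)) k
          (singularCohomology.map ℂ ℂ (⟨Subtype.val, continuous_subtype_val⟩ :
            C({e : Motives.ComplexPoints 𝒳 // Motives.AlgPoints.map f e = h y ∧ (y, e) ∉ C},
              Motives.ComplexPoints 𝒳)) k A) := by
    change (singularCohomology.map ℂ ℂ (Motives.AlgPoints.mapContinuous (L := ℂ)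
      (Motives.fiberι f (h y))) k ≫ singularCohomology.map ℂ ℂ _ k) A = _
    rw [← singularCohomology.map_comp, hfac, singularCohomology.map_comp, ModuleCat.comp_apply]
  rw [LinearMap.mem_ker]
  change complexBetti.restrictCompl (Motives.fiberOver f (h y)) (Z y) k
      (complexBetti.map (Motives.fiberι f (h y)) k A) = 0 ↔ _
  rw [hcomp]
  exact (singularCohomology.mapIso ℂ ℂ β k).toLinearEquiv.map_eq_zero_iff

/-- **Upper semicontinuity of supports, on the real carriers.** Let `f : 𝒳 ⟶ S` be proper with `𝒳`
separated over `ℂ`, such that `f(ℂ)` is topologically locally trivial (trivialisations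
`V × F₀ ≃ f(ℂ)⁻¹V` near every point, e.g. Ehresmann) and `S(ℂ)` is locally path connected; let
`h : Y → S(ℂ)` be continuous, `C ⊆ Y × 𝒳(ℂ)` closed, and `Z y ⊆ 𝒳_{h y}` (`y ∈ Y`) subsets of the
scheme-theoretic fibres whose complex points are cut out by `C`: `pt P ∈ Z y ↔ (y, ι_{h y}(P)) ∈ C`.
Then for every global class `A ∈ Hᵏ(𝒳(ℂ); ℂ)` the set of parameters
`{y | A|_{𝒳_{h y}} ∈ ker (Hᵏ(𝒳_{h y}(ℂ)) → Hᵏ((𝒳_{h y} ∖ Z y)(ℂ)))}` (`complexBetti.restrictCompl`)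
is CLOSED in `Y`: supports of the members of a closed family only grow in the limit.
(`map_fiberι_mem_ker_restrictCompl_iff` and the topological theorem
`isClosed_setOf_map_subtypeVal_eq_zero`.) [folklore] -/
theorem isClosed_setOf_map_fiberι_mem_ker_restrictCompl [IsProper f.left] [IsSeparated 𝒳.hom]
    (hf : ∀ t : Motives.ComplexPoints S, ∃ V : Set (Motives.ComplexPoints S), IsOpen V ∧ t ∈ V ∧
      ∃ (F₀ : Type) (_ : TopologicalSpace F₀)
        (φ : V × F₀ ≃ₜ (Motives.AlgPoints.map f : Motives.ComplexPoints 𝒳 → _) ⁻¹' V),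
        ∀ x, Motives.AlgPoints.map f (φ x : Motives.ComplexPoints 𝒳) =
          (x.1 : Motives.ComplexPoints S))
    [LocallyPathConnectedSpace (Motives.ComplexPoints S)] (h : C(Y, Motives.ComplexPoints S))
    {C : Set (Y × Motives.ComplexPoints 𝒳)} (hC : IsClosed C)
    (Z : ∀ y : Y, Set (Motives.fiberOver f (h y)).left)
    (hZ : ∀ (y : Y) (P : Motives.ComplexPoints (Motives.fiberOver f (h y))),
      P.pt ∈ Z y ↔ (y, Motives.AlgPoints.map (Motives.fiberι f (h y)) P) ∈ C)
    (k : ℕ) (A : complexBetti 𝒳 k) :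
    IsClosed {y : Y | complexBetti.map (Motives.fiberι f (h y)) k A ∈
      LinearMap.ker (complexBetti.restrictCompl (Motives.fiberOver f (h y)) (Z y) k).hom} := by
  have heq : {y : Y | complexBetti.map (Motives.fiberι f (h y)) k A ∈
      LinearMap.ker (complexBetti.restrictCompl (Motives.fiberOver f (h y)) (Z y) k).hom} =
        {y : Y | singularCohomology.map ℂ ℂ
          (⟨Subtype.val, continuous_subtype_val⟩ :
            C({e : Motives.ComplexPoints 𝒳 // Motives.AlgPoints.map f e = h y ∧ (y, e) ∉ C},
              Motives.ComplexPoints 𝒳)) k A = 0} :=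
    Set.ext fun y => map_fiberι_mem_ker_restrictCompl_iff f h C Z hZ k A y
  rw [heq]
  exact isClosed_setOf_map_subtypeVal_eq_zero ℂ hf h hC A

end Schemes

/-! ### Smooth projective families over a smooth base -/

section Smooth

open Literature.AlgebraicGeometry.Motives

variable {𝒳 S : Motives.SchemeOver ℂ}

/-- **`S(ℂ)` is locally path connected for `S` smooth over `ℂ`** (of possibly varying relative
dimension): `S` is covered by the opens `S_N` on which it is smooth of relative dimension `N`
(`Motives.exists_smoothPieces`), each `S_N(ℂ)` is a real `2N`-manifold
(`Motives.ComplexPoints.chartedSpace`, Serre GAGA §2), hence locally path connected, and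
`S_N(ℂ) ↪ S(ℂ)` is an open embedding (`AlgPoints.isOpenEmbedding_map_holds`). [folklore] -/
theorem locallyPathConnectedSpace_complexPoints_of_smooth (S : Motives.SchemeOver ℂ)
    [Smooth S.hom] [LocallyOfFiniteType S.hom] :
    LocallyPathConnectedSpace (Motives.ComplexPoints S) := by
  obtain ⟨piece, hsm, hcov, -, -⟩ := Motives.exists_smoothPieces S
  refine ⟨fun x => hasBasis_self.2 fun T hT => ?_⟩
  obtain ⟨N, hN⟩ := hcov x.pt
  -- the piece through `x` as a smooth `ℂ`-scheme of relative dimension `N`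
  let SV : Motives.SchemeOver ℂ := openSubschemeOver S (piece N)
  let iS : SV ⟶ S := openSubschemeOverι S (piece N)
  haveI : SmoothOfRelativeDimension N SV.hom := hsm N
  haveI : LocallyOfFiniteType SV.hom :=
    inferInstanceAs (LocallyOfFiniteType ((piece N).ι ≫ S.hom))
  haveI : IsOpenImmersion iS.left := inferInstanceAs (IsOpenImmersion (piece N).ι)
  have hiSe :
      IsOpenEmbedding (AlgPoints.map iS : Motives.ComplexPoints SV → Motives.ComplexPoints S) :=
    AlgPoints.isOpenEmbedding_map_holds iS
  have hrS : Set.range (AlgPoints.map iS : Motives.ComplexPoints SV → Motives.ComplexPoints S) =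
      {s | s.pt ∈ piece N} := by
    rw [AlgPoints.range_map_of_isOpenImmersion_holds iS]
    ext Q
    change Q.pt ∈ (piece N).ι.opensRange ↔ Q.pt ∈ piece N
    rw [Scheme.Opens.opensRange_ι]
  obtain ⟨x', rfl⟩ : x ∈ Set.range (AlgPoints.map iS : Motives.ComplexPoints SV → _) := by
    rw [hrS]; exact hN
  -- a path connected neighbourhood upstairs, pushed down along the open embedding
  letI := Motives.ComplexPoints.chartedSpace SV N
  haveI : LocallyPathConnectedSpace (Motives.ComplexPoints SV) :=
    ChartedSpace.locallyPathConnectedSpace (EuclideanSpace ℝ (Fin (2 * N)))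
      (Motives.ComplexPoints SV)
  have hT' : AlgPoints.map iS ⁻¹' T ∈ 𝓝 x' := hiSe.continuous.continuousAt.preimage_mem_nhds hT
  obtain ⟨W, ⟨hWn, hWpc⟩, hWT⟩ := (path_connected_basis x').mem_iff.1 hT'
  refine ⟨AlgPoints.map iS '' W, hiSe.isOpenMap.image_mem_nhds hWn, hWpc.image hiSe.continuous,
    ?_⟩
  rintro _ ⟨w, hw, rfl⟩
  exact hWT hw

/-- **Ehresmann over a smooth base of varying dimension.** For `f : 𝒳 ⟶ S` proper and smooth of
relative dimension `n` between separated `ℂ`-schemes with second countable complex points, `S`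
smooth over `ℂ` (of possibly varying relative dimension) and locally of finite type, `f(ℂ)` is
topologically locally trivial near every `t ∈ S(ℂ)` (`V × F₀ ≃ f(ℂ)⁻¹V` over `V`, the fibre `F₀`
being that of the restricted family): over each open piece `S_N` of constant relative dimension
(`Motives.exists_smoothPieces`) this is Ehresmann's theorem on complex points
(`Motives.ComplexPoints.isLocallyTrivialFibration_map_of_smoothOfRelativeDimension`) for the
restricted family `f⁻¹S_N ⟶ S_N`, transported along the open embeddings `f⁻¹S_N(ℂ) ↪ 𝒳(ℂ)`,
`S_N(ℂ) ↪ S(ℂ)` (`IsLocallyTrivialFibration.exists_trivialisation_of_isOpenEmbedding`).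
[cite: VoisinHodgeI2002, Thm. 9.3] -/
theorem exists_trivialisation_map_of_smooth (f : 𝒳 ⟶ S) (n : ℕ)
    [SmoothOfRelativeDimension n f.left] [IsProper f.left] [Smooth S.hom]
    [LocallyOfFiniteType S.hom] [IsSeparated S.hom] [IsSeparated 𝒳.hom]
    [SecondCountableTopology (Motives.ComplexPoints 𝒳)]
    [SecondCountableTopology (Motives.ComplexPoints S)] (t : Motives.ComplexPoints S) :
    ∃ V : Set (Motives.ComplexPoints S), IsOpen V ∧ t ∈ V ∧
      ∃ (F₀ : Type) (_ : TopologicalSpace F₀)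
        (φ : V × F₀ ≃ₜ (Motives.AlgPoints.map f : Motives.ComplexPoints 𝒳 → _) ⁻¹' V),
        ∀ x, Motives.AlgPoints.map f (φ x : Motives.ComplexPoints 𝒳) =
          (x.1 : Motives.ComplexPoints S) := by
  obtain ⟨piece, hsm, hcov, -, -⟩ := Motives.exists_smoothPieces S
  obtain ⟨N, hN⟩ := hcov t.pt
  let V₀ := piece N
  let 𝒳V : Motives.SchemeOver ℂ := openSubschemeOver 𝒳 (f.left ⁻¹ᵁ V₀)
  let SV : Motives.SchemeOver ℂ := openSubschemeOver S V₀
  let fV : 𝒳V ⟶ SV := restrictOverHom f V₀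
  let iX : 𝒳V ⟶ 𝒳 := openSubschemeOverι 𝒳 (f.left ⁻¹ᵁ V₀)
  let iS : SV ⟶ S := openSubschemeOverι S V₀
  haveI : SmoothOfRelativeDimension N SV.hom := hsm N
  haveI : LocallyOfFiniteType SV.hom := inferInstanceAs (LocallyOfFiniteType (V₀.ι ≫ S.hom))
  haveI : IsOpenImmersion iX.left := inferInstanceAs (IsOpenImmersion (f.left ⁻¹ᵁ V₀).ι)
  haveI : IsOpenImmersion iS.left := inferInstanceAs (IsOpenImmersion V₀.ι)
  haveI : IsSeparated SV.hom := inferInstanceAs (IsSeparated (V₀.ι ≫ S.hom))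
  haveI : IsSeparated 𝒳V.hom := inferInstanceAs (IsSeparated ((f.left ⁻¹ᵁ V₀).ι ≫ 𝒳.hom))
  haveI : IsProper fV.left := inferInstanceAs (IsProper (f.left ∣_ V₀))
  haveI : SmoothOfRelativeDimension n fV.left :=
    IsZariskiLocalAtTarget.restrict (P := @SmoothOfRelativeDimension n) ‹_› V₀
  have hiXe :
      IsOpenEmbedding (AlgPoints.map iX : Motives.ComplexPoints 𝒳V → Motives.ComplexPoints 𝒳) :=
    AlgPoints.isOpenEmbedding_map_holds iX
  have hiSe :
      IsOpenEmbedding (AlgPoints.map iS : Motives.ComplexPoints SV → Motives.ComplexPoints S) :=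
    AlgPoints.isOpenEmbedding_map_holds iS
  haveI : SecondCountableTopology (Motives.ComplexPoints 𝒳V) :=
    hiXe.isEmbedding.secondCountableTopology
  haveI : SecondCountableTopology (Motives.ComplexPoints SV) :=
    hiSe.isEmbedding.secondCountableTopology
  have htriv :=
    Motives.ComplexPoints.isLocallyTrivialFibration_map_of_smoothOfRelativeDimension n N fV
  -- ranges of the open embeddings
  have hrS : Set.range (AlgPoints.map iS : Motives.ComplexPoints SV → Motives.ComplexPoints S) =
      {s | s.pt ∈ V₀} := by
    rw [AlgPoints.range_map_of_isOpenImmersion_holds iS]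
    ext Q
    change Q.pt ∈ V₀.ι.opensRange ↔ Q.pt ∈ V₀
    rw [Scheme.Opens.opensRange_ι]
  have hrX : Set.range (AlgPoints.map iX : Motives.ComplexPoints 𝒳V → Motives.ComplexPoints 𝒳) =
      {P | P.pt ∈ f.left ⁻¹ᵁ V₀} := by
    rw [AlgPoints.range_map_of_isOpenImmersion_holds iX]
    ext Q
    change Q.pt ∈ (f.left ⁻¹ᵁ V₀).ι.opensRange ↔ Q.pt ∈ f.left ⁻¹ᵁ V₀
    rw [Scheme.Opens.opensRange_ι]
  obtain ⟨t', rfl⟩ : t ∈ Set.range (AlgPoints.map iS : Motives.ComplexPoints SV → _) := by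
    rw [hrS]; exact hN
  have hcomm : ∀ e' : Motives.ComplexPoints 𝒳V,
      AlgPoints.map f (AlgPoints.map iX e') = AlgPoints.map iS (AlgPoints.map fV e') := fun e' => by
    have h := congrArg (fun ψ => (AlgPoints.map ψ e' : Motives.ComplexPoints S))
      (restrictOverHom_comp_openSubschemeOverι f V₀)
    simp only [AlgPoints.map_comp_apply] at h
    exact h.symm
  have hrange : (AlgPoints.map f : Motives.ComplexPoints 𝒳 → Motives.ComplexPoints S) ⁻¹'
      Set.range (AlgPoints.map iS : Motives.ComplexPoints SV → Motives.ComplexPoints S) ⊆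
        Set.range (AlgPoints.map iX : Motives.ComplexPoints 𝒳V → Motives.ComplexPoints 𝒳) := by
    rw [hrS, hrX]
    intro P hP
    exact hP
  obtain ⟨V, hVo, htV, -, φ, hφ⟩ := htriv.exists_trivialisation_of_isOpenEmbedding hiXe hiSe
    (AlgPoints.continuous_map f) hcomm hrange t'
  exact ⟨V, hVo, htV, _, inferInstance, φ, hφ⟩

end Smooth

/-! ### Smooth projective families over a smooth quasi-projective base; slices of `𝒵 ⊆ 𝒳 × H` -/

section Families

open Literature.AlgebraicGeometry.Motives MonoidalCategory CartesianMonoidalCategory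

variable {𝒳 S : Motives.SchemeOver ℂ} (f : 𝒳 ⟶ S) {Y : Type} [TopologicalSpace Y]

/-- **Upper semicontinuity of supports for a smooth projective family over a smooth base.** For
`f : 𝒳 ⟶ S` a smooth projective family of relative dimension `n`
(`Motives.IsSmoothProjectiveFamily`) over a quasi-projective `S` smooth over `ℂ`, a continuous
`h : Y → S(ℂ)`, a closed `C ⊆ Y × 𝒳(ℂ)` and subsets `Z y ⊆ 𝒳_{h y}` of the fibres whose complex
points are cut out by `C`, the set
`{y | A|_{𝒳_{h y}} ∈ ker (Hᵏ(𝒳_{h y}(ℂ)) → Hᵏ((𝒳_{h y} ∖ Z y)(ℂ)))}` is closed in `Y`, for every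
`A ∈ Hᵏ(𝒳(ℂ); ℂ)` (Ehresmann on complex points, `exists_trivialisation_map_of_smooth`; `S(ℂ)`
is locally path connected, `locallyPathConnectedSpace_complexPoints_of_smooth`; `𝒳(ℂ)`, `S(ℂ)` are
second countable, Serre). [cite: VoisinHodgeI2002, Thm. 9.3 and §9.2.1] -/
theorem isClosed_setOf_map_fiberι_mem_ker_restrictCompl_of_isSmoothProjectiveFamily {n : ℕ}
    (hfam : Motives.IsSmoothProjectiveFamily f n) (hS : IsQuasiProjectiveOver S)
    (hSsm : Smooth S.hom) (h : C(Y, Motives.ComplexPoints S))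
    {C : Set (Y × Motives.ComplexPoints 𝒳)} (hC : IsClosed C)
    (Z : ∀ y : Y, Set (Motives.fiberOver f (h y)).left)
    (hZ : ∀ (y : Y) (P : Motives.ComplexPoints (Motives.fiberOver f (h y))),
      P.pt ∈ Z y ↔ (y, Motives.AlgPoints.map (Motives.fiberι f (h y)) P) ∈ C)
    (k : ℕ) (A : complexBetti 𝒳 k) :
    IsClosed {y : Y | complexBetti.map (Motives.fiberι f (h y)) k A ∈
      LinearMap.ker (complexBetti.restrictCompl (Motives.fiberOver f (h y)) (Z y) k).hom} := by
  haveI := hSsm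
  haveI : LocallyOfFiniteType S.hom := hS.locallyOfFiniteType
  haveI : IsSeparated S.hom := hS.isVarietyPair_ofScheme.isSeparated
  haveI : QuasiCompact S.hom := hS.isVarietyPair_ofScheme.quasiCompact
  haveI : CompactSpace S.left := QuasiCompact.compactSpace_of_compactSpace S.hom
  haveI := hfam.smoothOfRelativeDimension
  haveI := hfam.isProper
  haveI : IsSeparated 𝒳.hom := by rw [← Over.w f]; infer_instance
  haveI : LocallyOfFiniteType 𝒳.hom := by rw [← Over.w f]; infer_instance
  haveI : CompactSpace 𝒳.left := QuasiCompact.compactSpace_of_compactSpace f.left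
  haveI : SecondCountableTopology (Motives.ComplexPoints 𝒳) :=
    Motives.ComplexPoints.secondCountableTopology_of_compactSpace_holds 𝒳
  haveI : SecondCountableTopology (Motives.ComplexPoints S) :=
    Motives.ComplexPoints.secondCountableTopology_of_compactSpace_holds S
  haveI := locallyPathConnectedSpace_complexPoints_of_smooth S
  exact isClosed_setOf_map_fiberι_mem_ker_restrictCompl f (exists_trivialisation_map_of_smooth f n)
    h hC Z hZ k A

/-- The underlying point of `X` is continuous on `X(ℂ)` (the strong topology refines the Zariski
topology: `AlgPoints.isOpen_setOf_pt_mem`). [folklore] -/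
theorem continuous_pt_complexPoints (X : Motives.SchemeOver ℂ) :
    Continuous (AlgPoints.pt : Motives.ComplexPoints X → X.left) :=
  continuous_def.2 fun U hU => AlgPoints.isOpen_setOf_pt_mem (X := X) (L := ℂ) ⟨U, hU⟩

variable {H : Motives.SchemeOver ℂ}

/-- **Slices of a closed subset of `𝒳 × H` over the points of `H`.** For `y ∈ H(ℂ)` over `t ∈ S(ℂ)`
(along `g : H ⟶ S`) the fibre `𝒳_t` maps to `𝒳 × H` by `(ι_t, y)`; the preimage `Z y ⊆ 𝒳_t` of a
subset `𝒵 ⊆ 𝒳 × H` has complex points cut out by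
`C = {(y, Q) | (Q, y) ∈ 𝒵(ℂ)} ⊆ H(ℂ) × 𝒳(ℂ)` (`(𝒳 × H)(ℂ) = 𝒳(ℂ) × H(ℂ)`, `AlgPoints.prodEquiv`):
`pt P ∈ Z y ↔ (y, ι_t P) ∈ C`. [folklore] -/
theorem pt_mem_preimage_lift_iff (g : H ⟶ S) (𝒵 : Set (𝒳 ⊗ H).left) (y : Motives.ComplexPoints H)
    (P : Motives.ComplexPoints (Motives.fiberOver f (AlgPoints.map g y))) :
    P.pt ∈ (lift (Motives.fiberι f (AlgPoints.map g y))
        (Motives.fiberOverToSpec f (AlgPoints.map g y) ≫ y)).left.base ⁻¹' 𝒵 ↔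
      (y, AlgPoints.map (Motives.fiberι f (AlgPoints.map g y)) P) ∈
        {x : Motives.ComplexPoints H × Motives.ComplexPoints 𝒳 |
          (AlgPoints.prodEquiv.symm (x.2, x.1) : Motives.ComplexPoints (𝒳 ⊗ H)).pt ∈ 𝒵} := by
  have h1 : AlgPoints.map (lift (Motives.fiberι f (AlgPoints.map g y))
      (Motives.fiberOverToSpec f (AlgPoints.map g y) ≫ y)) P =
        AlgPoints.prodEquiv.symm (AlgPoints.map (Motives.fiberι f (AlgPoints.map g y)) P, y) := by
    rw [AlgPoints.prodEquiv_symm_apply, AlgPoints.map_apply, comp_lift, ← Category.assoc,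
      ← AlgPoints.map_apply (Motives.fiberOverToSpec f _) P,
      AlgPoints.endSpecOver_eq_id (AlgPoints.map (Motives.fiberOverToSpec f _) P),
      Category.id_comp]
    rfl
  rw [Set.mem_preimage, Set.mem_setOf_eq, ← h1]
  rfl

/-- `C = {(y, Q) | (Q, y) ∈ 𝒵(ℂ)}` is closed in `H(ℂ) × 𝒳(ℂ)` for `𝒵 ⊆ 𝒳 × H` Zariski closed
(`(𝒳 × H)(ℂ) ≃ₜ 𝒳(ℂ) × H(ℂ)`, `AlgPoints.continuous_prodEquiv_symm`; `pt` is continuous).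
[folklore] -/
theorem isClosed_setOf_pt_prodEquiv_symm_mem {𝒵 : Set (𝒳 ⊗ H).left} (h𝒵 : IsClosed 𝒵) :
    IsClosed {x : Motives.ComplexPoints H × Motives.ComplexPoints 𝒳 |
      (AlgPoints.prodEquiv.symm (x.2, x.1) : Motives.ComplexPoints (𝒳 ⊗ H)).pt ∈ 𝒵} := by
  have hsymm : Continuous (AlgPoints.prodEquiv.symm :
      Motives.ComplexPoints 𝒳 × Motives.ComplexPoints H → Motives.ComplexPoints (𝒳 ⊗ H)) :=
    AlgPoints.continuous_prodEquiv_symm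
  exact h𝒵.preimage ((continuous_pt_complexPoints (𝒳 ⊗ H)).comp
    (hsymm.comp (continuous_snd.prodMk continuous_fst)))

/-- **Upper semicontinuity of supports: families of subsets cut out by a closed subset of `𝒳 × H`.**
Let `f : 𝒳 ⟶ S` be a smooth projective family of relative dimension `n` over a quasi-projective
`S` smooth over `ℂ`, `g : H ⟶ S` any morphism of `ℂ`-schemes (the parameter scheme), and
`𝒵 ⊆ 𝒳 × H` Zariski closed; for `y ∈ H(ℂ)` let `Z y ⊆ 𝒳_{g(y)}` be the preimage of `𝒵` under
`(ι_{g(y)}, y) : 𝒳_{g(y)} → 𝒳 × H` (the member of the family over `y`). Then for every global class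
`A ∈ Hᵏ(𝒳(ℂ); ℂ)` the set of `y ∈ H(ℂ)` with
`A|_{𝒳_{g(y)}} ∈ ker (Hᵏ(𝒳_{g(y)}(ℂ); ℂ) → Hᵏ((𝒳_{g(y)} ∖ Z y)(ℂ); ℂ))` is CLOSED in `H(ℂ)`
(strong topology). With `k = 2p` and `𝒵` a family of codimension-`p` subschemes of the fibres this
is the analytic closedness of the good sets "`A|_{𝒳_t}` is supported on `Z_y`" of the structure
theorem on algebraicity loci. [cite: CharlesSchnell2014Notes, Prop. 11.3.11 (proof)]
[cite: VoisinHodgeII2003, §3.3.1 and §7.3.2] -/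
theorem isClosed_setOf_map_fiberι_mem_ker_restrictCompl_preimage {n : ℕ}
    (hfam : Motives.IsSmoothProjectiveFamily f n) (hS : IsQuasiProjectiveOver S)
    (hSsm : Smooth S.hom) (g : H ⟶ S) {𝒵 : Set (𝒳 ⊗ H).left} (h𝒵 : IsClosed 𝒵)
    (k : ℕ) (A : complexBetti 𝒳 k) :
    IsClosed {y : Motives.ComplexPoints H |
      complexBetti.map (Motives.fiberι f (AlgPoints.map g y)) k A ∈
        LinearMap.ker (complexBetti.restrictCompl (Motives.fiberOver f (AlgPoints.map g y))
          ((lift (Motives.fiberι f (AlgPoints.map g y))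
            (Motives.fiberOverToSpec f (AlgPoints.map g y) ≫ y)).left.base ⁻¹' 𝒵) k).hom} :=
  isClosed_setOf_map_fiberι_mem_ker_restrictCompl_of_isSmoothProjectiveFamily f hfam hS hSsm
    (AlgPoints.mapContinuous (L := ℂ) g) (isClosed_setOf_pt_prodEquiv_symm_mem h𝒵)
    (fun y => (lift (Motives.fiberι f (AlgPoints.map g y))
      (Motives.fiberOverToSpec f (AlgPoints.map g y) ≫ y)).left.base ⁻¹' 𝒵)
    (fun y P => pt_mem_preimage_lift_iff f g 𝒵 y P) k A

end Families

/-! ### Consequence: good sets are stable under Zariski closure of locally constructible pieces (SGA1 XII 2.2) -/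

section ZariskiClosure

open Literature.AlgebraicGeometry.Motives MonoidalCategory CartesianMonoidalCategory

variable {H : Motives.SchemeOver ℂ}

/-- Closed subsets of a locally Noetherian scheme are locally constructible (on an affine open,
a Noetherian topological space, every closed subset is constructible;
`Literature.NumberTheory.Transcendental.isConstructible_of_isClosed`). [folklore] -/
theorem isLocallyConstructible_of_isClosed {X : Scheme} [IsLocallyNoetherian X] {T : Set X}
    (hT : IsClosed T) : IsLocallyConstructible T := by
  intro x
  obtain ⟨_, ⟨V, hV, rfl⟩, hxV, -⟩ :=
    X.isBasis_affineOpens.exists_subset_of_mem_open (Set.mem_univ x) isOpen_univ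
  have : IsNoetherianRing Γ(X, V) := IsLocallyNoetherian.component_noetherian ⟨V, hV⟩
  have : TopologicalSpace.NoetherianSpace (V : Set X) := noetherianSpace_of_isAffineOpen V hV
  exact ⟨V, V.2.mem_nhds hxV, V.2,
    Literature.NumberTheory.Transcendental.isConstructible_of_isClosed
      (hT.preimage continuous_subtype_val)⟩

/-- A locally closed subset `W ∩ U` (`W` closed, `U` open) of a locally Noetherian scheme is locally
constructible. [folklore] -/
theorem isLocallyConstructible_inter_of_isClosed_of_isOpen {X : Scheme} [IsLocallyNoetherian X]
    {W U : Set X} (hW : IsClosed W) (hU : IsOpen U) : IsLocallyConstructible (W ∩ U) :=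
  (isLocallyConstructible_of_isClosed hW).inter
    (Literature.NumberTheory.Transcendental.isLocallyConstructible_of_isOpen hU)

variable [LocallyOfFiniteType H.hom]

/-- **A strongly closed set of complex points containing `T(ℂ)` contains `T̄(ℂ)`** for `T ⊆ H`
locally constructible (`H` locally of finite type over `ℂ`): by SGA1 XII Prop. 2.2 (the tree's
PROVED `Motives.ComplexPoints.closure_setOf_pt_mem_holds`) the complex points over the Zariski
closure `T̄` form the strong closure of the complex points over `T`.
[cite: SGA1, Exp. XII Prop. 2.2] -/
theorem setOf_pt_mem_closure_subset_of_isClosed {G : Set (Motives.ComplexPoints H)}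
    (hG : IsClosed G) {T : Set H.left} (hT : IsLocallyConstructible T)
    (hTG : {P : Motives.ComplexPoints H | P.pt ∈ T} ⊆ G) :
    {P : Motives.ComplexPoints H | P.pt ∈ closure T} ⊆ G := by
  rw [← Motives.ComplexPoints.closure_setOf_pt_mem_holds H T hT]
  exact closure_minimal hTG hG

/-- **A strongly closed set which is a union of `T_i(ℂ)`, `T_i` locally constructible, is the union
of the `T̄_i(ℂ)`** — in particular a strongly closed COUNTABLE union of locally constructible
pieces is a countable union of (the complex points of) Zariski-CLOSED subsets. This is how the
analytic closedness of the good sets upgrades constructible pieces to closed subvarieties in the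
structure theorem on algebraicity loci. [cite: SGA1, Exp. XII Prop. 2.2] -/
theorem eq_iUnion_setOf_pt_mem_closure_of_isClosed {G : Set (Motives.ComplexPoints H)}
    (hG : IsClosed G) {ι : Sort*} (T : ι → Set H.left) (hT : ∀ i, IsLocallyConstructible (T i))
    (hGT : G = ⋃ i, {P : Motives.ComplexPoints H | P.pt ∈ T i}) :
    G = ⋃ i, {P : Motives.ComplexPoints H | P.pt ∈ closure (T i)} := by
  apply Set.Subset.antisymm
  · rw [hGT]
    exact Set.iUnion_mono fun i P hP => subset_closure hP
  · refine Set.iUnion_subset fun i => setOf_pt_mem_closure_subset_of_isClosed hG (hT i) ?_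
    intro P hP
    rw [hGT]
    exact Set.mem_iUnion.2 ⟨i, hP⟩

variable {𝒳 S : Motives.SchemeOver ℂ} (f : 𝒳 ⟶ S)

/-- **Supportedness passes to the Zariski closure of a locally constructible set of parameters.**
In the situation of `isClosed_setOf_map_fiberι_mem_ker_restrictCompl_preimage` (a smooth projective
family `f : 𝒳 ⟶ S` over a smooth quasi-projective base, a parameter scheme `g : H ⟶ S` locally of
finite type, a Zariski-closed `𝒵 ⊆ 𝒳 × H` with slices `Z y ⊆ 𝒳_{g(y)}`, a global class `A`): if
`A|_{𝒳_{g(y)}}` dies off `Z y` for every complex point `y` over a locally constructible `T ⊆ H`,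
then it does so for every complex point over the Zariski closure `T̄` (the good set is strongly
closed, and `T̄(ℂ)` is the strong closure of `T(ℂ)`, SGA1 XII 2.2). For `T = W ∩ U` with `W`
irreducible closed and `U` open meeting `W`, `T̄ = W`: a condition verified at the complex points of
a dense open part of an irreducible parameter variety holds at ALL its complex points.
[cite: CharlesSchnell2014Notes, Prop. 11.3.11 (proof)] [cite: SGA1, Exp. XII Prop. 2.2] -/
theorem map_fiberι_mem_ker_restrictCompl_of_pt_mem_closure {n : ℕ}
    (hfam : Motives.IsSmoothProjectiveFamily f n) (hS : IsQuasiProjectiveOver S)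
    (hSsm : Smooth S.hom) (g : H ⟶ S) {𝒵 : Set (𝒳 ⊗ H).left} (h𝒵 : IsClosed 𝒵)
    (k : ℕ) (A : complexBetti 𝒳 k) {T : Set H.left} (hT : IsLocallyConstructible T)
    (hgood : ∀ y : Motives.ComplexPoints H, y.pt ∈ T →
      complexBetti.map (Motives.fiberι f (AlgPoints.map g y)) k A ∈
        LinearMap.ker (complexBetti.restrictCompl (Motives.fiberOver f (AlgPoints.map g y))
          ((lift (Motives.fiberι f (AlgPoints.map g y))
            (Motives.fiberOverToSpec f (AlgPoints.map g y) ≫ y)).left.base ⁻¹' 𝒵) k).hom)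
    (y : Motives.ComplexPoints H) (hy : y.pt ∈ closure T) :
    complexBetti.map (Motives.fiberι f (AlgPoints.map g y)) k A ∈
      LinearMap.ker (complexBetti.restrictCompl (Motives.fiberOver f (AlgPoints.map g y))
        ((lift (Motives.fiberι f (AlgPoints.map g y))
          (Motives.fiberOverToSpec f (AlgPoints.map g y) ≫ y)).left.base ⁻¹' 𝒵) k).hom := by
  -- the good set and its strong closedness
  set G : Set (Motives.ComplexPoints H) := {y : Motives.ComplexPoints H |
      complexBetti.map (Motives.fiberι f (AlgPoints.map g y)) k A ∈
        LinearMap.ker (complexBetti.restrictCompl (Motives.fiberOver f (AlgPoints.map g y))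
          ((lift (Motives.fiberι f (AlgPoints.map g y))
            (Motives.fiberOverToSpec f (AlgPoints.map g y) ≫ y)).left.base ⁻¹' 𝒵) k).hom} with hG
  have hGc : IsClosed G :=
    isClosed_setOf_map_fiberι_mem_ker_restrictCompl_preimage f hfam hS hSsm g h𝒵 k A
  have hTG : {P : Motives.ComplexPoints H | P.pt ∈ T} ⊆ G := fun P hP => hgood P hP
  have hyG : y ∈ G := setOf_pt_mem_closure_subset_of_isClosed hGc hT hTG hy
  exact hyG

end ZariskiClosure

end HodgeTheory

end Literature.AlgebraicGeometry.HodgeTheory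

end
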